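import Literature.AlgebraicGeometry.Modules.PullbackPushforwardTwist
import Literature.AlgebraicGeometry.Modules.PullbackFlatMono
import HarnessLib

/-!
# The counit `p^* p_* F ⟶ F` is an epimorphism when `F` is generated by its sections over the preimages of affine opens

[Hartshorne1977] II §5 (p. 110; Thm. 5.17 — Serre's theorem A) / [StacksProject, Tag 01AM] (globally generated sheaves of modules):
a sheaf `F` on `X` is RELATIVELY GLOBALLY GENERATED with respect to `p : X ⟶ S` when the counit
`ε_F : p^* p_* F ⟶ F` of `p^* ⊣ p_*` is an epimorphism; for `p` projective and `F = 𝓘(n)`, `n ≫ 0`, this is relative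
theorem A.  The cell's (h6-d) chain (★ `Morphisms/ContainmentRepOfPushforward`) takes `Epi ε_F` as the NAMED INPUT (hgen).

THIS FILE reduces (hgen) to the textbook chart statement: writing `η_p(s)|_U ∈ Γ(U, p^* p_* F)` for the pulled-back section of
`s ∈ Γ(p_*F, V) = Γ(F, p⁻¹V)` restricted to `U ⊆ p⁻¹V` (★ `Modules/PullbackAffineChart.unitSectionLE`),

* `counit_app_unitSectionLE` — `ε_F(η_p(s)|_U) = s|_U` (a triangle identity, ★ `PullbackPushforwardTwist.counit_app_unitSection`);
* **`epi_counit_of_span_restrict_eq_top`** — if for all affine `V ⊆ S` and affine `U ⊆ p⁻¹V` the restrictions `s|_U` of the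
  sections `s ∈ Γ(F, p⁻¹V)` SPAN `Γ(F, U)` over `Γ(X, U)`, then `ε_F` is an epimorphism (surjective on the basis of such `U`,
  ★ `PullbackFlatMono.isBasis_affineOpens_le_preimage`, ★ `IsoOfSectionsOnBasis.epi_of_surjective_on_basis`);
* `epi_counit_of_forall_exists_sum` — the same with the span hypothesis spelled as finite sums `x = Σ c_k · s_k|_U`.

No affine-localizing / quasi-coherence hypothesis is needed (only the inclusion «span of pulled-back sections ↠» is used).
Theorems only; no `sorry`, no instance, no named fact.  Cell hodgecm-mathlib, F-DAG second wave (h6-d) FILE E (the (hgen) adapter).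
HC_CM is proved only modulo the printed citations until rung 0 closes; this file discharges none of them.

## References
* [Hartshorne1977] R. Hartshorne, *Algebraic Geometry* (1977), II §5 p. 110 (`f^* ⊣ f_*`), II Thm. 5.17 (Serre), III §8.
* [StacksProject] The Stacks Project, Tag 01AM (globally generated modules), Tag 01CB (functoriality / adjunction).
-/

noncomputable section

-- `TopCat.Presheaf`/`Scheme.Modules` are not reducible (as in Mathlib's `AlgebraicGeometry/Modules/Sheaf.lean`).
set_option backward.isDefEq.respectTransparency false

open CategoryTheory CategoryTheory.Limits AlgebraicGeometry TopologicalSpace Opposite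

universe u

namespace Literature.AlgebraicGeometry.Modules

section CounitEpi

variable {X S : Scheme.{u}} (p : X ⟶ S) (F : X.Modules)

/-- **`ε_F(η_p(s)|_U) = s|_U`** for `s ∈ Γ(p_*F, V) = Γ(F, p⁻¹V)` and `U ⊆ p⁻¹V`: the counit undoes the unit on sections
(★ `counit_app_unitSection`), restricted to `U`. [cite: Hartshorne1977, II §5 p. 110] [cite: StacksProject, Tag 01CB] -/
theorem counit_app_unitSectionLE {V : S.Opens} {U : X.Opens} (i : U ≤ p ⁻¹ᵁ V)
    (s : Γ((Scheme.Modules.pushforward p).obj F, V)) :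
    ((Scheme.Modules.pullbackPushforwardAdjunction p).counit.app F).app U
        (unitSectionLE p ((Scheme.Modules.pushforward p).obj F) i s) =
      F.presheaf.map (homOfLE i).op (show Γ(F, p ⁻¹ᵁ V) from s) := by
  simp only [unitSectionLE]
  erw [app_presheaf_map, counit_app_unitSection]
  rfl

/-- **Relative generation by sections makes the counit an epimorphism** ([Hartshorne1977] II §5; [StacksProject, Tag 01AM]):
if for every affine open `V ⊆ S` and affine open `U ⊆ p⁻¹V` the restrictions to `U` of the sections of `F` over `p⁻¹V` span
`Γ(F, U)` over `Γ(X, U)`, then `ε_F : p^* p_* F ⟶ F` is an epimorphism — every `s|_U` is `ε_F(η_p(s)|_U)`, `ε_F` is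
`Γ(X, U)`-linear on sections, and these `U` form a basis of `X`. [cite: Hartshorne1977, II §5 p. 110] [cite: StacksProject, Tag 01AM] -/
theorem epi_counit_of_span_restrict_eq_top
    (h : ∀ (V : S.Opens) (_ : IsAffineOpen V) (U : X.Opens) (_ : IsAffineOpen U) (i : U ≤ p ⁻¹ᵁ V),
      Submodule.span Γ(X, U) (Set.range fun s : Γ(F, p ⁻¹ᵁ V) => F.presheaf.map (homOfLE i).op s) = ⊤) :
    Epi ((Scheme.Modules.pullbackPushforwardAdjunction p).counit.app F) := by
  refine epi_of_surjective_on_basis _ (isBasis_affineOpens_le_preimage p) fun U hU' => ?_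
  obtain ⟨hU, V, hV, i⟩ := hU'
  -- `ε_U` as a `Γ(X, U)`-linear map
  let εl : Γ((Scheme.Modules.pullback p).obj ((Scheme.Modules.pushforward p).obj F), U) →ₗ[Γ(X, U)] Γ(F, U) :=
    { toFun := ((Scheme.Modules.pullbackPushforwardAdjunction p).counit.app F).app U
      map_add' := fun x y => map_add _ x y
      map_smul' := fun c x => Scheme.Modules.Hom.app_smul _ c x }
  have hrange : LinearMap.range εl = ⊤ := by
    rw [eq_top_iff, ← h V hV U hU i, Submodule.span_le]
    rintro _ ⟨s, rfl⟩
    exact ⟨unitSectionLE p ((Scheme.Modules.pushforward p).obj F) i (show Γ((Scheme.Modules.pushforward p).obj F, V) from s),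
      counit_app_unitSectionLE p F i s⟩
  change Function.Surjective εl
  exact LinearMap.range_eq_top.mp hrange

/-- The same with the generation hypothesis as FINITE SUMS: every `x ∈ Γ(F, U)` is `Σ_k c_k · s_k|_U` with
`s_k ∈ Γ(F, p⁻¹V)`, `c_k ∈ Γ(X, U)` (`Submodule.mem_span_range_iff_exists_fun`). [cite: Hartshorne1977, II §5 p. 110]
[cite: StacksProject, Tag 01AM] -/
theorem epi_counit_of_forall_exists_sum
    (h : ∀ (V : S.Opens) (_ : IsAffineOpen V) (U : X.Opens) (_ : IsAffineOpen U) (i : U ≤ p ⁻¹ᵁ V) (x : Γ(F, U)),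
      ∃ (n : ℕ) (c : Fin n → Γ(X, U)) (s : Fin n → Γ(F, p ⁻¹ᵁ V)),
        x = ∑ k, c k • F.presheaf.map (homOfLE i).op (s k)) :
    Epi ((Scheme.Modules.pullbackPushforwardAdjunction p).counit.app F) := by
  refine epi_counit_of_span_restrict_eq_top p F fun V hV U hU i => ?_
  rw [eq_top_iff]
  intro x _
  obtain ⟨n, c, s, rfl⟩ := h V hV U hU i x
  exact Submodule.sum_mem _ fun k _ =>
    Submodule.smul_mem _ _ (Submodule.subset_span ⟨s k, rfl⟩)

end CounitEpi

end Literature.AlgebraicGeometry.Modules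

end
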